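import Mathlib

/-!
# Jacobi-carry orientation — first lemma
crux-ideate round 1, seat 2, gen 3 · crux item `stmt-BirchSwinnertonDyer-25138`
(`EisensteinAdditiveManinResidual`, route `TwistFamilyManinDescent`; live child K18b″
`OrdinaryCornerDeepUnstarredNotBottom`, stmt-27662).

The twisting correspondence `T_χ = Σ_{c ∈ 𝔽_pˣ} χ(c)·[z ↦ z + c/p]` on `X₀(p²M)` permutes the
depth-one cusps `[a/(pm)]` (`a ∈ 𝔽_p`, fixed `m ∣ M`) by translation in `a`; on the Teichmüller
eigen-divisor `D_{(j),m} = Σ_{a ≠ 0} ω̃(a)^{-j} [a/(pm)]` it acts by the JACOBI SUM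
`T_χ D_{(j),m} = χ(m) · J(χ, ω̃^{-j}) · D_{(j + (p-1)/2), m}`, and `v_p J(χ, ω̃^{-j}) ∈ {0,1}` is the
Stickelberger CARRY.  The first lemma is the carry law, stated mod `p` (where it is an elementary
character-sum identity: binomial expansion + Lucas), plus the in-Lean check at `p = 5, 7`.
Nothing here proves K18b″, the crux, Manin `c = 1` or BSD.
-/

namespace Summit.BirchSwinnertonDyer.BirchSwinnertonDyer.Cruxes.EisensteinAdditiveManinResidual.JacobiCarryOrientation

/-- Reduction mod `p` of the Jacobi sum `J(χ_p, ω̃^{-j}) = Σ_x χ_p(x) ω̃^{-j}(1-x)`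
(`χ_p = ω^{(p-1)/2}` the quadratic character, `ω` the tautological character of `(ZMod p)ˣ`),
written as a raw character sum over `ZMod p` (the terms `x = 0, 1` vanish for `0 < j < p-1`). -/
def jacobiCarrySum (p j : ℕ) : ZMod p :=
  ∑ x ∈ Finset.range p, (x : ZMod p) ^ ((p - 1) / 2) * (1 - (x : ZMod p)) ^ (p - 1 - j)

/-- FIRST LEMMA (J1, valuation half — E-blind, elementary): for `p ≥ 5` prime and
`0 < j < p-1`, `j ≠ (p-1)/2`, the mod-`p` Jacobi sum vanishes iff `j` lies in the UPPER half,
i.e. `v_p J(χ_p, ω̃^{-j}) = [ (p-1)/2 < j ]` (Stickelberger / Gross–Koblitz; here: expand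
`(1-x)^{p-1-j}`, use `Σ_x x^k = -[p-1 ∣ k, k>0]`, and `p ∤ Nat.choose (p-1-j) ((p-1)/2)`). -/
def JacobiCarryLaw : Prop :=
  ∀ p : ℕ, p.Prime → 5 ≤ p → ∀ j : ℕ, 0 < j → j < p - 1 → j ≠ (p - 1) / 2 →
    (jacobiCarrySum p j = 0 ↔ (p - 1) / 2 < j)

/-- The complementary-exponent form used by the orientation argument: exactly one of the two
χ-twin eigen-exponents `j`, `j + (p-1)/2` carries. -/
def JacobiCarryComplement : Prop :=
  ∀ p : ℕ, p.Prime → 5 ≤ p → ∀ j : ℕ, 0 < j → j < (p - 1) / 2 →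
    (jacobiCarrySum p j ≠ 0 ∧ jacobiCarrySum p (j + (p - 1) / 2) = 0)

/-! In-Lean cheapest check on the primes of the three ordinary-corner rows (p = 5: exponents
j ∈ {1, 3}; p = 7: j ∈ {1, 2, 4, 5}): lower half does not carry, upper half carries. -/
example : jacobiCarrySum 5 1 ≠ 0 ∧ jacobiCarrySum 5 3 = 0 := by decide +kernel
example : jacobiCarrySum 7 1 ≠ 0 ∧ jacobiCarrySum 7 2 ≠ 0 ∧
    jacobiCarrySum 7 4 = 0 ∧ jacobiCarrySum 7 5 = 0 := by decide +kernel

end Summit.BirchSwinnertonDyer.BirchSwinnertonDyer.Cruxes.EisensteinAdditiveManinResidual.JacobiCarryOrientation
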